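import Summits.Ventures.CertifiedManyBodySolver.Upper.IntervalReaderSourcedTwoFieldNode
import Summits.Ventures.CertifiedManyBodySolver.Upper.ProducersFrameK2Node

/-!
# Ventures/CertifiedManyBodySolver — Upper/IntervalReaderObservableRows.lean: bytes ⇒ THE `docc` AND HOPPING ROWS
(part 36 of the Theorem-H1′ package; parts 1–35: `IntervalReaderSchur` … `IntervalReaderEmbedClaimNode`)

HONEST FRAMING: first certified bounds; not a superconductivity verdict; every number certified (two readers)
or labelled float.  An observable window of a certified finite-box vector (double occupancy, a hopping word) is a
pair of certified variational statements about ONE vector; it is never a sign of order and never an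
order-parameter word (LADDER v1.17 (i)).  This file composes already-landed theorems; it certifies no number and
moves no row.

THE `JOB_OBS` ROWS (ref-2c g29 precision P14).  Besides the energy / density / zero-field rows of parts 22–23 /
31–32, the `l3core-sgf` reader (`sgf_read.py`, block `JOB_OBS=1`) runs the SAME Theorem-H1′ sweep (`h1_moments`)
over two more transformed-frame words of the certificate's witness `ψ̃` (merge layout, `ab` sites, `d = 4`):

* `docc_model(a,b)` — `Σ_r ñ_{2r}(1 − ñ_{2r+1})`: no hopping, on-site `n↑ − n↑n↓`, i.e. the `sgf_model` tables at
  `(M, U, μ) = (0, 1, 0)`; the word is `N↑ − Σ_x n_{x↑}n_{x↓} = S′ᴴ (Σ_x n_{x↑}n_{x↓}) S′`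
  (ird-5's `gaugedShiba'_conjTranspose_conj_onSiteRepulsion`) — the `docc` rows of the eleven-conjunct
  `…_twoFieldDoccDiagHop` nodes;
* `khop_model(a,b,kind)` — the hopping word of a box graph `G` (`rectBoxDiagGraph` = `K₂`, `rectBoxGraph` = `K₁`):
  pure hopping tables `(p↑,q↑) = −t[p∼q]`, `(p↓,q↓) = ḡ_p g_q·t[p∼q]`, i.e. the `sgf_model` tables at
  `(M, U, μ) = (𝒦^ḡ_G, 0, 0)`, `𝒦_G = bdgNambuMatrix (−t[p∼q]) 0 0`; the word is
  `dΓ(𝒦^ḡ_G) = S′ᴴ · hamiltonian G t 0 · S′` (ird-5's `gaugedShiba'_conjTranspose_conj_hamiltonian_zero`) — the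
  `K₂` rows of the nine-conjunct `…_twoFieldDiagHop` nodes.

Both are instances of part 32's `quadraticWindow_of_reader`, so this file proves, for the FORMAT-mpsgf1 witness
`ψ̃ = toSpinVec⁻¹Ψ`, `Ψ k = mpsOpenVar (a·b) A l r (k ∘ e)` and the producers' real sign gauge `g = ±1`
(`S′ = partialParticleHole D↓ · orbitalPhase g`):

* `gaugedHopNambu_symm_of_sign` — `𝒦^ḡ_G` is symmetric;
* **`doccWindow_of_reader`** — bytes of the `(0,1,0)` sweep + the `Nrm` sweep + four by-value corner tests ⟹
  `d_lo·Re⟨ψ̃,ψ̃⟩ ≤ Re⟨ψ̃, S′ᴴ(Σ n↑n↓)S′ ψ̃⟩ ≤ d_hi·Re⟨ψ̃,ψ̃⟩`;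
* **`hoppingWindow_of_reader`** — bytes of the `(𝒦^ḡ_G,0,0)` sweep + `Nrm` + four corner tests ⟹
  `k_lo·Re⟨ψ̃,ψ̃⟩ ≤ Re⟨ψ̃, S′ᴴ·hamiltonian G t 0·S′ ψ̃⟩ ≤ k_hi·Re⟨ψ̃,ψ̃⟩` (any `G`, any `t`);
* **`sourcedBoxFourRowNode_of_gaugedShibaWitness'`** — the frame-level ELEVEN-conjunct node (ird-5's
  `sourcedBoxThreeRowNode_of_gaugedShibaWitness'` with the `docc` rows inserted before the `K₂` rows, x2dk order):
  the body of `cert_sgf_openbox32x4_U8_mu7o4_k3o7_j264564_twoFieldDoccDiagHop` up to `HasParity.mono`.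

Part 37 composes these with part 31's bytes into the nine- and eleven-conjunct nodes; part 38 is the embed layout.
Inputs outside the bytes, unchanged: the contractions (kit), the machine premises (A1)/(A2), the code tables =
`quadAutomaton` by value (`quadOnSite 0 1 0 e k = n↑ − n↑n↓`, `dGammaHop (orbPullback e 0) = 0`;
`quadOnSite 𝒦^ḡ 0 0 e = 0` since a graph has no loops), the corner tests by value.
-/

noncomputable section

open Matrix Finset WithLp
open scoped BigOperators ComplexOrder Matrix.Norms.L2Operator

namespace Summit.Ventures.CertifiedManyBodySolver.Upper.IntervalReader

open Literature.MathematicalPhysics.QuantumLattice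
open Literature.MathematicalPhysics.QuantumLattice.JordanWigner
open Literature.MathematicalPhysics.QuantumLattice.TwoCluster (HasParity)

/-! ## §AA  The gauged hopping matrix is symmetric -/

section HopMatrix

variable {Λ : Type*} [LinearOrder Λ] [Fintype Λ] (G : SimpleGraph Λ) [DecidableRel G.Adj]

/-- **`𝒦^ḡ_G` is symmetric** for a real sign gauge `g i = ±1`: the hop-only Nambu matrix
`bdgNambuMatrix (−t[p∼q]) 0 0` has blocks `∓t[p∼q]` (symmetric, `G.Adj` is symmetric) and zero spin-off-diagonal
blocks. -/
theorem gaugedHopNambu_symm_of_sign (t : ℝ) {g : Orb Λ → ℂ} (hg : ∀ i, g i = 1 ∨ g i = -1) (i j : Orb Λ) :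
    (Matrix.of fun i j : Orb Λ => star (g i) * g j *
        bdgNambuMatrix (fun u v : Λ => if G.Adj u v then -(t : ℂ) else 0) 0 0 i j) i j =
      (Matrix.of fun i j : Orb Λ => star (g i) * g j *
        bdgNambuMatrix (fun u v : Λ => if G.Adj u v then -(t : ℂ) else 0) 0 0 i j) j i := by
  have hreal : ∀ i, star (g i) = g i := fun i => by
    rcases hg i with h1 | h1 <;> simp [h1]
  have hK : bdgNambuMatrix (fun u v : Λ => if G.Adj u v then -(t : ℂ) else 0) 0 0 i j =
      bdgNambuMatrix (fun u v : Λ => if G.Adj u v then -(t : ℂ) else 0) 0 0 j i := by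
    have hi : i = orb (ofLex i).1 (ofLex i).2 := rfl
    have hj : j = orb (ofLex j).1 (ofLex j).2 := rfl
    rw [hi, hj, bdgNambuMatrix_orb_orb, bdgNambuMatrix_orb_orb]
    have hadj : G.Adj (ofLex j).1 (ofLex i).1 ↔ G.Adj (ofLex i).1 (ofLex j).1 := ⟨fun h' => h'.symm, fun h' => h'.symm⟩
    by_cases hs : (ofLex i).2 = 0 <;> by_cases hs' : (ofLex j).2 = 0 <;>
      simp only [hs, hs', if_true, if_false, Pi.zero_apply, add_zero, star_zero, neg_zero, Complex.ofReal_zero,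
        ite_self, sub_zero, hadj, @eq_comm _ (ofLex j).1 (ofLex i).1]
  rw [Matrix.of_apply, Matrix.of_apply, hreal, hreal, hK]
  ring

end HopMatrix

/-! ## §BB  The `docc` and hopping windows from the reader's bytes (merge layout) -/

section Windows

variable {a b D : ℕ}

/-- **Bytes of the `docc_model` sweep ⇒ the DOUBLE-OCCUPANCY window** (producers' frame, any `|g| = 1` real sign
gauge).  The sweep is ird-3's automaton at `(M, U, μ) = (0, 1, 0)`; with the shared `Nrm` sweep and the four by-value
corner tests (`hd1`/`hd2` lower edge `d_lo`, `hd3`/`hd4` upper edge `d_hi`, totals — the row's `dlo·ab`, `dhi·ab`):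
`d_lo·Re⟨ψ̃,ψ̃⟩ ≤ Re⟨ψ̃, S′ᴴ (Σ_x n_{x↑}n_{x↓}) S′ ψ̃⟩ ≤ d_hi·Re⟨ψ̃,ψ̃⟩`. -/
theorem doccWindow_of_reader {g : Orb (Fin a ×ₗ Fin b) → ℂ} (hg : ∀ i, g i = 1 ∨ g i = -1)
    (e : Fin (a * b) ≃ (Fin a ×ₗ Fin b)) (he : ∀ i j, e i < e j ↔ i < j) (A : Fin (a * b) → MPSTensor 4 D)
    (l r : Fin D → ℂ) (κ : Fin (a * b) → ℝ) (hκ0 : ∀ k, 0 ≤ κ k)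
    (hκ : ∀ k (z : EuclideanSpace ℂ (Fin D)), ∑ s, ‖toLp 2 (A k s *ᵥ ofLp z)‖ ^ 2 ≤ κ k * ‖z‖ ^ 2)
    (Md : Fin (a * b) → QState (a * b) → QState (a * b) → ℝ) (hMd0 : ∀ k b' c, 0 ≤ Md k b' c)
    (hMdrow : ∀ k b' c s, ∑ s', ‖quadAutomaton (dGammaHop (orbPullback e
      (0 : Matrix (Orb (Fin a ×ₗ Fin b)) (Orb (Fin a ×ₗ Fin b)) ℂ))) (fun _ _ _ _ => 0)
      (quadOnSite (0 : Matrix (Orb (Fin a ×ₗ Fin b)) (Orb (Fin a ×ₗ Fin b)) ℂ) 1 0 e) k b' c s s'‖ ≤ Md k b' c)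
    (hMdcol : ∀ k b' c s', ∑ s, ‖quadAutomaton (dGammaHop (orbPullback e
      (0 : Matrix (Orb (Fin a ×ₗ Fin b)) (Orb (Fin a ×ₗ Fin b)) ℂ))) (fun _ _ _ _ => 0)
      (quadOnSite (0 : Matrix (Orb (Fin a ×ₗ Fin b)) (Orb (Fin a ×ₗ Fin b)) ℂ) 1 0 e) k b' c s s'‖ ≤ Md k b' c)
    (YX : Fin (a * b + 1) → QState (a * b) → Matrix (Fin D) (Fin D) ℂ) (ρX : Fin (a * b) → QState (a * b) → ℝ)
    (hρX : ∀ (k : Fin (a * b)) (c : QState (a * b)),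
      ‖YX k.succ c - ∑ b', transferOp (A k) (quadAutomaton (dGammaHop (orbPullback e
        (0 : Matrix (Orb (Fin a ×ₗ Fin b)) (Orb (Fin a ×ₗ Fin b)) ℂ))) (fun _ _ _ _ => 0)
        (quadOnSite (0 : Matrix (Orb (Fin a ×ₗ Fin b)) (Orb (Fin a ×ₗ Fin b)) ℂ) 1 0 e) k b' c)
        (YX k.castSucc b')‖ ≤ ρX k c)
    (radX : Fin (a * b + 1) → QState (a * b) → ℝ)
    (hrX0 : ∀ b', ‖YX 0 b' -
      (Pi.single QState.start (vecMulVec (star l) l) : QState (a * b) → Matrix (Fin D) (Fin D) ℂ) b'‖ ≤ radX 0 b')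
    (hrX : ∀ (k : Fin (a * b)) (c : QState (a * b)),
      ∑ b', Md k b' c * κ k * radX k.castSucc b' + ρX k c ≤ radX k.succ c)
    (YN : Fin (a * b + 1) → Matrix (Fin D) (Fin D) ℂ) (ρN : Fin (a * b) → ℝ)
    (hρN : ∀ k : Fin (a * b), ‖YN k.succ - transferOp (A k) 1 (YN k.castSucc)‖ ≤ ρN k)
    (radN : Fin (a * b + 1) → ℝ) (hrN0 : ‖YN 0 - vecMulVec (star l) l‖ ≤ radN 0)
    (hrN : ∀ k : Fin (a * b), 1 * κ k * radN k.castSucc + ρN k ≤ radN k.succ)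
    (dlo dhi : ℝ)
    (hd1 : dlo * ((star r ⬝ᵥ (YN (Fin.last (a * b)) *ᵥ r)).re - (∑ i, ‖r i‖) * (∑ i, ‖r i‖) * radN (Fin.last (a * b)))
      ≤ (star r ⬝ᵥ (YX (Fin.last (a * b)) QState.fin *ᵥ r)).re -
        (∑ i, ‖r i‖) * (∑ i, ‖r i‖) * radX (Fin.last (a * b)) QState.fin)
    (hd2 : dlo * ((star r ⬝ᵥ (YN (Fin.last (a * b)) *ᵥ r)).re + (∑ i, ‖r i‖) * (∑ i, ‖r i‖) * radN (Fin.last (a * b)))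
      ≤ (star r ⬝ᵥ (YX (Fin.last (a * b)) QState.fin *ᵥ r)).re -
        (∑ i, ‖r i‖) * (∑ i, ‖r i‖) * radX (Fin.last (a * b)) QState.fin)
    (hd3 : (star r ⬝ᵥ (YX (Fin.last (a * b)) QState.fin *ᵥ r)).re +
        (∑ i, ‖r i‖) * (∑ i, ‖r i‖) * radX (Fin.last (a * b)) QState.fin ≤
      dhi * ((star r ⬝ᵥ (YN (Fin.last (a * b)) *ᵥ r)).re - (∑ i, ‖r i‖) * (∑ i, ‖r i‖) * radN (Fin.last (a * b))))
    (hd4 : (star r ⬝ᵥ (YX (Fin.last (a * b)) QState.fin *ᵥ r)).re +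
        (∑ i, ‖r i‖) * (∑ i, ‖r i‖) * radX (Fin.last (a * b)) QState.fin ≤
      dhi * ((star r ⬝ᵥ (YN (Fin.last (a * b)) *ᵥ r)).re + (∑ i, ‖r i‖) * (∑ i, ‖r i‖) * radN (Fin.last (a * b)))) :
    let Ψ : TensorIndex (Fin a ×ₗ Fin b) 4 → ℂ := fun k => mpsOpenVar (a * b) A l r (fun i => k (e i))
    dlo * (star (toSpinVec.symm Ψ) ⬝ᵥ toSpinVec.symm Ψ).re ≤
        (star (toSpinVec.symm Ψ) ⬝ᵥ
          (((partialParticleHole (spinDownOrbitals : Finset (Orb (Fin a ×ₗ Fin b))) * orbitalPhase g)ᴴ *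
              (∑ x : Fin a ×ₗ Fin b, numberOp x 0 * numberOp x 1) *
              (partialParticleHole (spinDownOrbitals : Finset (Orb (Fin a ×ₗ Fin b))) * orbitalPhase g)) *ᵥ
            toSpinVec.symm Ψ)).re ∧
      (star (toSpinVec.symm Ψ) ⬝ᵥ
          (((partialParticleHole (spinDownOrbitals : Finset (Orb (Fin a ×ₗ Fin b))) * orbitalPhase g)ᴴ *
              (∑ x : Fin a ×ₗ Fin b, numberOp x 0 * numberOp x 1) *
              (partialParticleHole (spinDownOrbitals : Finset (Orb (Fin a ×ₗ Fin b))) * orbitalPhase g)) *ᵥ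
            toSpinVec.symm Ψ)).re ≤
        dhi * (star (toSpinVec.symm Ψ) ⬝ᵥ toSpinVec.symm Ψ).re := by
  intro Ψ
  have hg' : ∀ i, ‖g i‖ = 1 := fun i => by rcases hg i with h1 | h1 <;> simp [h1]
  rw [gaugedShiba'_conjTranspose_conj_onSiteRepulsion hg']
  have W := quadraticWindow_of_reader (0 : Matrix (Orb (Fin a ×ₗ Fin b)) (Orb (Fin a ×ₗ Fin b)) ℂ)
    (fun _ _ => rfl) 1 0 e he A l r κ hκ0 hκ Md hMd0 hMdrow hMdcol YX ρX hρX radX hrX0 hrX YN ρN hρN radN hrN0 hrN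
    dlo dhi hd1 hd2 hd3 hd4
  simp only [dGamma_zero, Complex.ofReal_zero, zero_mul, zero_smul, sub_zero, Complex.ofReal_one, one_smul,
    zero_add] at W
  exact W

/-- **Bytes of the `khop_model` sweep ⇒ the HOPPING-WORD window** of a box graph `G` (`rectBoxDiagGraph a b`: the
`K₂` rows; `rectBoxGraph a b`: the `K₁` decomposition check), producers' frame.  The sweep is ird-3's automaton
at `(M, U, μ) = (𝒦^ḡ_G, 0, 0)`, `𝒦^ḡ_G = (ḡ_i g_j · bdgNambuMatrix (−t[p∼q]) 0 0)_{ij}`; with the shared `Nrm` sweep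
and four corner tests: `k_lo·Re⟨ψ̃,ψ̃⟩ ≤ Re⟨ψ̃, S′ᴴ·hamiltonian G t 0·S′ ψ̃⟩ ≤ k_hi·Re⟨ψ̃,ψ̃⟩`. -/
theorem hoppingWindow_of_reader (G : SimpleGraph (Fin a ×ₗ Fin b)) [DecidableRel G.Adj] (t : ℝ)
    {g : Orb (Fin a ×ₗ Fin b) → ℂ} (hg : ∀ i, g i = 1 ∨ g i = -1)
    (e : Fin (a * b) ≃ (Fin a ×ₗ Fin b)) (he : ∀ i j, e i < e j ↔ i < j) (A : Fin (a * b) → MPSTensor 4 D)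
    (l r : Fin D → ℂ) (κ : Fin (a * b) → ℝ) (hκ0 : ∀ k, 0 ≤ κ k)
    (hκ : ∀ k (z : EuclideanSpace ℂ (Fin D)), ∑ s, ‖toLp 2 (A k s *ᵥ ofLp z)‖ ^ 2 ≤ κ k * ‖z‖ ^ 2)
    (Mk : Fin (a * b) → QState (a * b) → QState (a * b) → ℝ) (hMk0 : ∀ k b' c, 0 ≤ Mk k b' c)
    (hMkrow : ∀ k b' c s, ∑ s', ‖quadAutomaton (dGammaHop (orbPullback e
      (Matrix.of fun i j : Orb (Fin a ×ₗ Fin b) => star (g i) * g j *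
        bdgNambuMatrix (fun u v : Fin a ×ₗ Fin b => if G.Adj u v then -(t : ℂ) else 0) 0 0 i j))) (fun _ _ _ _ => 0)
      (quadOnSite (Matrix.of fun i j : Orb (Fin a ×ₗ Fin b) => star (g i) * g j *
        bdgNambuMatrix (fun u v : Fin a ×ₗ Fin b => if G.Adj u v then -(t : ℂ) else 0) 0 0 i j) 0 0 e)
        k b' c s s'‖ ≤ Mk k b' c)
    (hMkcol : ∀ k b' c s', ∑ s, ‖quadAutomaton (dGammaHop (orbPullback e
      (Matrix.of fun i j : Orb (Fin a ×ₗ Fin b) => star (g i) * g j *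
        bdgNambuMatrix (fun u v : Fin a ×ₗ Fin b => if G.Adj u v then -(t : ℂ) else 0) 0 0 i j))) (fun _ _ _ _ => 0)
      (quadOnSite (Matrix.of fun i j : Orb (Fin a ×ₗ Fin b) => star (g i) * g j *
        bdgNambuMatrix (fun u v : Fin a ×ₗ Fin b => if G.Adj u v then -(t : ℂ) else 0) 0 0 i j) 0 0 e)
        k b' c s s'‖ ≤ Mk k b' c)
    (YK : Fin (a * b + 1) → QState (a * b) → Matrix (Fin D) (Fin D) ℂ) (ρK : Fin (a * b) → QState (a * b) → ℝ)
    (hρK : ∀ (k : Fin (a * b)) (c : QState (a * b)),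
      ‖YK k.succ c - ∑ b', transferOp (A k) (quadAutomaton (dGammaHop (orbPullback e
        (Matrix.of fun i j : Orb (Fin a ×ₗ Fin b) => star (g i) * g j *
          bdgNambuMatrix (fun u v : Fin a ×ₗ Fin b => if G.Adj u v then -(t : ℂ) else 0) 0 0 i j)))
        (fun _ _ _ _ => 0)
        (quadOnSite (Matrix.of fun i j : Orb (Fin a ×ₗ Fin b) => star (g i) * g j *
          bdgNambuMatrix (fun u v : Fin a ×ₗ Fin b => if G.Adj u v then -(t : ℂ) else 0) 0 0 i j) 0 0 e) k b' c)
        (YK k.castSucc b')‖ ≤ ρK k c)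
    (radK : Fin (a * b + 1) → QState (a * b) → ℝ)
    (hrK0 : ∀ b', ‖YK 0 b' -
      (Pi.single QState.start (vecMulVec (star l) l) : QState (a * b) → Matrix (Fin D) (Fin D) ℂ) b'‖ ≤ radK 0 b')
    (hrK : ∀ (k : Fin (a * b)) (c : QState (a * b)),
      ∑ b', Mk k b' c * κ k * radK k.castSucc b' + ρK k c ≤ radK k.succ c)
    (YN : Fin (a * b + 1) → Matrix (Fin D) (Fin D) ℂ) (ρN : Fin (a * b) → ℝ)
    (hρN : ∀ k : Fin (a * b), ‖YN k.succ - transferOp (A k) 1 (YN k.castSucc)‖ ≤ ρN k)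
    (radN : Fin (a * b + 1) → ℝ) (hrN0 : ‖YN 0 - vecMulVec (star l) l‖ ≤ radN 0)
    (hrN : ∀ k : Fin (a * b), 1 * κ k * radN k.castSucc + ρN k ≤ radN k.succ)
    (klo khi : ℝ)
    (hk1 : klo * ((star r ⬝ᵥ (YN (Fin.last (a * b)) *ᵥ r)).re - (∑ i, ‖r i‖) * (∑ i, ‖r i‖) * radN (Fin.last (a * b)))
      ≤ (star r ⬝ᵥ (YK (Fin.last (a * b)) QState.fin *ᵥ r)).re -
        (∑ i, ‖r i‖) * (∑ i, ‖r i‖) * radK (Fin.last (a * b)) QState.fin)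
    (hk2 : klo * ((star r ⬝ᵥ (YN (Fin.last (a * b)) *ᵥ r)).re + (∑ i, ‖r i‖) * (∑ i, ‖r i‖) * radN (Fin.last (a * b)))
      ≤ (star r ⬝ᵥ (YK (Fin.last (a * b)) QState.fin *ᵥ r)).re -
        (∑ i, ‖r i‖) * (∑ i, ‖r i‖) * radK (Fin.last (a * b)) QState.fin)
    (hk3 : (star r ⬝ᵥ (YK (Fin.last (a * b)) QState.fin *ᵥ r)).re +
        (∑ i, ‖r i‖) * (∑ i, ‖r i‖) * radK (Fin.last (a * b)) QState.fin ≤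
      khi * ((star r ⬝ᵥ (YN (Fin.last (a * b)) *ᵥ r)).re - (∑ i, ‖r i‖) * (∑ i, ‖r i‖) * radN (Fin.last (a * b))))
    (hk4 : (star r ⬝ᵥ (YK (Fin.last (a * b)) QState.fin *ᵥ r)).re +
        (∑ i, ‖r i‖) * (∑ i, ‖r i‖) * radK (Fin.last (a * b)) QState.fin ≤
      khi * ((star r ⬝ᵥ (YN (Fin.last (a * b)) *ᵥ r)).re + (∑ i, ‖r i‖) * (∑ i, ‖r i‖) * radN (Fin.last (a * b)))) :
    let Ψ : TensorIndex (Fin a ×ₗ Fin b) 4 → ℂ := fun k => mpsOpenVar (a * b) A l r (fun i => k (e i))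
    klo * (star (toSpinVec.symm Ψ) ⬝ᵥ toSpinVec.symm Ψ).re ≤
        (star (toSpinVec.symm Ψ) ⬝ᵥ
          (((partialParticleHole (spinDownOrbitals : Finset (Orb (Fin a ×ₗ Fin b))) * orbitalPhase g)ᴴ *
              hamiltonian G t 0 *
              (partialParticleHole (spinDownOrbitals : Finset (Orb (Fin a ×ₗ Fin b))) * orbitalPhase g)) *ᵥ
            toSpinVec.symm Ψ)).re ∧
      (star (toSpinVec.symm Ψ) ⬝ᵥ
          (((partialParticleHole (spinDownOrbitals : Finset (Orb (Fin a ×ₗ Fin b))) * orbitalPhase g)ᴴ *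
              hamiltonian G t 0 *
              (partialParticleHole (spinDownOrbitals : Finset (Orb (Fin a ×ₗ Fin b))) * orbitalPhase g)) *ᵥ
            toSpinVec.symm Ψ)).re ≤
        khi * (star (toSpinVec.symm Ψ) ⬝ᵥ toSpinVec.symm Ψ).re := by
  intro Ψ
  have hg' : ∀ i, ‖g i‖ = 1 := fun i => by rcases hg i with h1 | h1 <;> simp [h1]
  rw [gaugedShiba'_conjTranspose_conj_hamiltonian_zero G t hg']
  have W := quadraticWindow_of_reader (Matrix.of fun i j : Orb (Fin a ×ₗ Fin b) => star (g i) * g j *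
      bdgNambuMatrix (fun u v : Fin a ×ₗ Fin b => if G.Adj u v then -(t : ℂ) else 0) 0 0 i j)
    (gaugedHopNambu_symm_of_sign G t hg) 0 0 e he A l r κ hκ0 hκ Mk hMk0 hMkrow hMkcol YK ρK hρK radK hrK0 hrK YN
    ρN hρN radN hrN0 hrN klo khi hk1 hk2 hk3 hk4
  simp only [Complex.ofReal_zero, zero_mul, zero_smul, sub_zero, add_zero] at W
  exact W

end Windows

/-! ## §CC  The frame-level ELEVEN-conjunct node -/

section FourRow

variable (a b : ℕ)

/-- **FOUR-ROW node from a witness in the frame `S′ = W · orbitalPhase g`** (ird-5's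
`sourcedBoxThreeRowNode_of_gaugedShibaWitness'` plus the `docc` rows, x2dk order `[u, nlo, nhi, e0lo, e0hi, dlo, dhi,
k2lo, k2hi]`): an `Ñ`-particle `ψ̃` with `⟨ψ̃,ψ̃⟩ > 0` and cleared Rayleigh rows of `S′ᴴ X S′` for
`X ∈ {A_C(μ,h) (upper), N, A_C(μ,0), Σ n↑n↓, hamiltonian (rectBoxDiagGraph a b) 1 0}` (windows) yields ONE unit
vector `ψ = S′ψ̃/‖ψ̃‖` of parity `Ñ + ab` carrying all eleven conjuncts. [cite: Lieb1989, proof of Theorem 2] -/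
theorem sourcedBoxFourRowNode_of_gaugedShibaWitness' (U μ h : ℝ) (e nlo nhi e0lo e0hi dlo dhi k2lo k2hi : ℚ)
    {g : Orb (Fin a ×ₗ Fin b) → ℂ} (hg : ∀ i, ‖g i‖ = 1) {Nt : ℕ} (ψt : Fock (Orb (Fin a ×ₗ Fin b)))
    (hN : IsNParticle Nt ψt) (hpos : 0 < (star ψt ⬝ᵥ ψt).re)
    (hE : (star ψt ⬝ᵥ (((partialParticleHole (spinDownOrbitals : Finset (Orb (Fin a ×ₗ Fin b))) * orbitalPhase g)ᴴ *
            dWaveSourceOpenBox a b U μ h *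
            (partialParticleHole (spinDownOrbitals : Finset (Orb (Fin a ×ₗ Fin b))) * orbitalPhase g)) *ᵥ ψt)).re
          ≤ (e : ℝ) * ((a : ℝ) * b) * (star ψt ⬝ᵥ ψt).re)
    (hlo : (nlo : ℝ) * ((a : ℝ) * b) * (star ψt ⬝ᵥ ψt).re ≤
          (star ψt ⬝ᵥ (((partialParticleHole (spinDownOrbitals : Finset (Orb (Fin a ×ₗ Fin b))) * orbitalPhase g)ᴴ *
            totalNumber * (partialParticleHole (spinDownOrbitals : Finset (Orb (Fin a ×ₗ Fin b))) * orbitalPhase g)) *ᵥ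
              ψt)).re)
    (hhi : (star ψt ⬝ᵥ (((partialParticleHole (spinDownOrbitals : Finset (Orb (Fin a ×ₗ Fin b))) * orbitalPhase g)ᴴ *
            totalNumber * (partialParticleHole (spinDownOrbitals : Finset (Orb (Fin a ×ₗ Fin b))) * orbitalPhase g)) *ᵥ
              ψt)).re
          ≤ (nhi : ℝ) * ((a : ℝ) * b) * (star ψt ⬝ᵥ ψt).re)
    (h0lo : (e0lo : ℝ) * ((a : ℝ) * b) * (star ψt ⬝ᵥ ψt).re ≤
          (star ψt ⬝ᵥ (((partialParticleHole (spinDownOrbitals : Finset (Orb (Fin a ×ₗ Fin b))) * orbitalPhase g)ᴴ *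
            dWaveSourceOpenBox a b U μ 0 *
            (partialParticleHole (spinDownOrbitals : Finset (Orb (Fin a ×ₗ Fin b))) * orbitalPhase g)) *ᵥ ψt)).re)
    (h0hi : (star ψt ⬝ᵥ (((partialParticleHole (spinDownOrbitals : Finset (Orb (Fin a ×ₗ Fin b))) * orbitalPhase g)ᴴ *
            dWaveSourceOpenBox a b U μ 0 *
            (partialParticleHole (spinDownOrbitals : Finset (Orb (Fin a ×ₗ Fin b))) * orbitalPhase g)) *ᵥ ψt)).re
          ≤ (e0hi : ℝ) * ((a : ℝ) * b) * (star ψt ⬝ᵥ ψt).re)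
    (hdlo : (dlo : ℝ) * ((a : ℝ) * b) * (star ψt ⬝ᵥ ψt).re ≤
          (star ψt ⬝ᵥ (((partialParticleHole (spinDownOrbitals : Finset (Orb (Fin a ×ₗ Fin b))) * orbitalPhase g)ᴴ *
            (∑ x : Fin a ×ₗ Fin b, numberOp x 0 * numberOp x 1) *
            (partialParticleHole (spinDownOrbitals : Finset (Orb (Fin a ×ₗ Fin b))) * orbitalPhase g)) *ᵥ ψt)).re)
    (hdhi : (star ψt ⬝ᵥ (((partialParticleHole (spinDownOrbitals : Finset (Orb (Fin a ×ₗ Fin b))) * orbitalPhase g)ᴴ *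
            (∑ x : Fin a ×ₗ Fin b, numberOp x 0 * numberOp x 1) *
            (partialParticleHole (spinDownOrbitals : Finset (Orb (Fin a ×ₗ Fin b))) * orbitalPhase g)) *ᵥ ψt)).re
          ≤ (dhi : ℝ) * ((a : ℝ) * b) * (star ψt ⬝ᵥ ψt).re)
    (hk2lo : (k2lo : ℝ) * ((a : ℝ) * b) * (star ψt ⬝ᵥ ψt).re ≤
          (star ψt ⬝ᵥ (((partialParticleHole (spinDownOrbitals : Finset (Orb (Fin a ×ₗ Fin b))) * orbitalPhase g)ᴴ *
            hamiltonian (rectBoxDiagGraph a b) 1 0 *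
            (partialParticleHole (spinDownOrbitals : Finset (Orb (Fin a ×ₗ Fin b))) * orbitalPhase g)) *ᵥ ψt)).re)
    (hk2hi : (star ψt ⬝ᵥ (((partialParticleHole (spinDownOrbitals : Finset (Orb (Fin a ×ₗ Fin b))) * orbitalPhase g)ᴴ *
            hamiltonian (rectBoxDiagGraph a b) 1 0 *
            (partialParticleHole (spinDownOrbitals : Finset (Orb (Fin a ×ₗ Fin b))) * orbitalPhase g)) *ᵥ ψt)).re
          ≤ (k2hi : ℝ) * ((a : ℝ) * b) * (star ψt ⬝ᵥ ψt).re) :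
    ∃ ψ : Fock (Orb (Fin a ×ₗ Fin b)), HasParity (Nt + a * b) ψ ∧ star ψ ⬝ᵥ ψ = 1 ∧
      (star ψ ⬝ᵥ (dWaveSourceOpenBox a b U μ h *ᵥ ψ)).re ≤ ((e : ℚ) : ℝ) * ((a : ℝ) * b) ∧
      ((nlo : ℚ) : ℝ) * ((a : ℝ) * b) ≤ (star ψ ⬝ᵥ (totalNumber *ᵥ ψ)).re ∧
      (star ψ ⬝ᵥ (totalNumber *ᵥ ψ)).re ≤ ((nhi : ℚ) : ℝ) * ((a : ℝ) * b) ∧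
      ((e0lo : ℚ) : ℝ) * ((a : ℝ) * b) ≤ (star ψ ⬝ᵥ (dWaveSourceOpenBox a b U μ 0 *ᵥ ψ)).re ∧
      (star ψ ⬝ᵥ (dWaveSourceOpenBox a b U μ 0 *ᵥ ψ)).re ≤ ((e0hi : ℚ) : ℝ) * ((a : ℝ) * b) ∧
      ((dlo : ℚ) : ℝ) * ((a : ℝ) * b) ≤
        (star ψ ⬝ᵥ ((∑ x : Fin a ×ₗ Fin b, numberOp x 0 * numberOp x 1) *ᵥ ψ)).re ∧
      (star ψ ⬝ᵥ ((∑ x : Fin a ×ₗ Fin b, numberOp x 0 * numberOp x 1) *ᵥ ψ)).re ≤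
        ((dhi : ℚ) : ℝ) * ((a : ℝ) * b) ∧
      ((k2lo : ℚ) : ℝ) * ((a : ℝ) * b) ≤ (star ψ ⬝ᵥ (hamiltonian (rectBoxDiagGraph a b) 1 0 *ᵥ ψ)).re ∧
      (star ψ ⬝ᵥ (hamiltonian (rectBoxDiagGraph a b) 1 0 *ᵥ ψ)).re ≤ ((k2hi : ℚ) : ℝ) * ((a : ℝ) * b) := by
  set S := partialParticleHole (spinDownOrbitals : Finset (Orb (Fin a ×ₗ Fin b))) * orbitalPhase g with hS
  have hSS : Sᴴ * S = 1 :=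
    conjTranspose_mul_self_of_mul (partialParticleHole_conjTranspose_mul _) (conjTranspose_orbitalPhase_mul hg)
  refine ⟨(((1 / Real.sqrt (star ψt ⬝ᵥ ψt).re : ℝ)) : ℂ) • (S *ᵥ ψt), ?_, star_dotProduct_normalisedFrame hSS ψt hpos,
    ?_, ?_, ?_, ?_, ?_, ?_, ?_, ?_, ?_⟩
  · exact hasParity_smul _ (hasParity_gaugedShiba'_mulVec a b g hN)
  · simpa using observableUpper_of_frameRow S (dWaveSourceOpenBox a b U μ h) ψt hpos (hi := (e : ℝ))
      (c := (a : ℝ) * b) hE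
  · simpa using observableLower_of_frameRow S totalNumber ψt hpos (lo := (nlo : ℝ)) (c := (a : ℝ) * b) hlo
  · simpa using observableUpper_of_frameRow S totalNumber ψt hpos (hi := (nhi : ℝ)) (c := (a : ℝ) * b) hhi
  · simpa using observableLower_of_frameRow S (dWaveSourceOpenBox a b U μ 0) ψt hpos (lo := (e0lo : ℝ))
      (c := (a : ℝ) * b) h0lo
  · simpa using observableUpper_of_frameRow S (dWaveSourceOpenBox a b U μ 0) ψt hpos (hi := (e0hi : ℝ))
      (c := (a : ℝ) * b) h0hi
  · simpa using observableLower_of_frameRow S (∑ x : Fin a ×ₗ Fin b, numberOp x 0 * numberOp x 1) ψt hpos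
      (lo := (dlo : ℝ)) (c := (a : ℝ) * b) hdlo
  · simpa using observableUpper_of_frameRow S (∑ x : Fin a ×ₗ Fin b, numberOp x 0 * numberOp x 1) ψt hpos
      (hi := (dhi : ℝ)) (c := (a : ℝ) * b) hdhi
  · simpa using observableLower_of_frameRow S (hamiltonian (rectBoxDiagGraph a b) 1 0) ψt hpos (lo := (k2lo : ℝ))
      (c := (a : ℝ) * b) hk2lo
  · simpa using observableUpper_of_frameRow S (hamiltonian (rectBoxDiagGraph a b) 1 0) ψt hpos (hi := (k2hi : ℝ))
      (c := (a : ℝ) * b) hk2hi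

end FourRow

end Summit.Ventures.CertifiedManyBodySolver.Upper.IntervalReader

end
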